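import Summits.NavierStokesRegularity.NavierStokesRegularity.Theses.RellichScar
import Summits.NavierStokesRegularity.NavierStokesRegularity.Theorems.SymmetricScarExists.Negative.SpiralWorld
import Summits.NavierStokesRegularity.NavierStokesRegularity.Theorems.SymmetricScarExists.Negative.RepairedAssembly
import Summits.NavierStokesRegularity.NavierStokesRegularity.Theorems.RellichScarSimilarityCovariance
import Summits.NavierStokesRegularity.NavierStokesRegularity.Theorems.SymmetricScarExists.Negative.TargetCostume
import Summits.NavierStokesRegularity.NavierStokesRegularity.Theorems.RellichScarSelfSimilarApexFatal
import Summits.NavierStokesRegularity.NavierStokesRegularity.Theorems.RellichScarAxisymmetricApexFatal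

/- LANDING FILE (strategist evidence copy, published in the crux dir so that leads can READ it; `Theorems/` is prover-only).
   A prover lands this file VERBATIM as `Summits/NavierStokesRegularity/NavierStokesRegularity/Theorems/RellichScarSymmetricScarExistsSplit.lean`
   (`ledger propose --target … --supports stmt-NavierStokesRegularity-11718`) with the namespace line restored to
   `Summit.NavierStokesRegularity.NavierStokesRegularity.Theorems.SymmetricScarExists.RdssSplit` (this copy uses `.Cruxes.….GlueLanding`
   only to avoid a duplicate-declaration clash once the Theorems copy exists). lean check rc 0, 0 sorries, axioms propext/Classical.choice/Quot.sound. -/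

/-!
# Crux `SymmetricScarExists` (stmt-NavierStokesRegularity-11718): the RDSS (screw) SPLIT

Strategist file (crux-strategist seat, `--supports stmt-NavierStokesRegularity-11718`; theorems only, no
definitions, no named facts).  It lands the glue of a typed decomposition of the crux
`S = SymmetricScarExists` ("if a singular apex Type-I profile exists, one exists whose scar is
(−1)-homogeneous or axisymmetric") into three children, each STRICTLY WEAKER than an existing statement of
route RellichScar and none a rewording of `S`:

* **RdssScarSelection** (`Sel`, weaker than `S`): if a singular apex profile exists, then one exists whose
  scar is fixed by ONE non-trivial screw-dilation `x ↦ c R_θ x` (`c > 1`; scar of `R_θ D_c u` = scar of `u`)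
  — or is axisymmetric.  This is the selection a dynamical engine on the compact apex class can deliver:
  compact orbits of `ℝ₊ × SO(2)` acting on scars are the screw-periodic ones (rotated discretely
  self-similar scars), not fixed points (Disproof §4–§5, §9 of the crux work file; idea katok-closing-rdss).
* **RdssScarRigidity** (`Rig`, weaker than `ScarRigidity`): a singular apex profile whose scar is fixed by
  a screw-dilation `g = (c, θ)`, `c > 1`, is itself a.e. fixed by `g` on the slab — scar rigidity for the
  pair `(u, g·u)` only (`rdssScarRigidity_of_scarRigidity`).
* **RdssApexFatal** (`Fatal`, weaker than the target `NoApexTypeIProfile`): no singular apex profile is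
  a.e. fixed by a screw-dilation with `c > 1` — the Type-I rotated-discretely-self-similar Liouville
  problem about the `x₃`-axis in apex-class form (Bradshaw–Tsai 2017 OP 5.1, Tsai GSM 192 Conj. 8.8–8.9,
  Pineau–Vicol 2026 Conj. 1.1 / Thm 1.7; canonical tree conjecture
  `Summit.NavierStokesRegularity.NavierStokesRegularity.TypeIDSSLiouvilleConjecture`); landed corners:
  `dssApexFatal_nearOne` (θ = 0, `c` near 1, Chae–Wolf 2017 Thm 1.3) and `rssApexFatal_smallOrLargePitch`
  (Pineau–Vicol Thm 1.4).  It contains Perelman's RSS problem: `rssApexFatal_of_rdssApexFatal`.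

Glue `symmetricScarExists_of_rdssSplit : Sel → Rig → Fatal → S` (pure logic: the screw branch is emptied
by `Rig` then `Fatal`; the axisymmetric branch is a witness of `S` verbatim).  Calibration theorems:
`rdssScarSelection_of_symmetricScarExists` (`S → Sel`), `rdssScarRigidity_of_scarRigidity`
(`ScarRigidity → Rig`, covariance discharged by the landed `similarityCovariance_proof`),
`rdssApexFatal_of_noApexTypeIProfile` (`X → Fatal`), `rssApexFatal_of_rdssApexFatal`
(`Fatal → ∀ α, RssApexFatal α`), `selfSimilar_hypothesis_of_rdssApexFatal` (`Fatal` kills a.e.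
self-similar singular apex profiles, the hypothesis of the proved `SelfSimilarApexFatal`).

The children's statements are written INLINE (verbatim sub-formulas of the route file; the screw action is
`fun t x => rotZ θ (nsRescale c u t (rotZ (-θ) x))`, definitionally `conjZ θ (nsRescale c u)` of
`Negative.SpiralWorld`), so that the glue's type is literally `RdssScarSelection → RdssScarRigidity → RdssApexFatal → SymmetricScarExists` once the three children are rendered in the route file.

References: Z. Bradshaw, T.-P. Tsai, Comm. PDE 42 (2017) = arXiv:1610.05680, §5 OP 5.1
[BradshawTsai2017CPDE]; D. Chae, J. Wolf, arXiv:1610.09464, Thm 1.3 [ChaeWolf2017RemovingDSS];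
B. Pineau, V. Vicol, arXiv:2607.09619, Conj. 1.1, Thms 1.4, 1.7 [PineauVicol2026]; T.-P. Tsai, GSM 192
(2018), Conj. 8.8–8.9 [Tsai2018]; A. Katok, Publ. IHÉS 51 (1980) [Katok1980].
-/

noncomputable section

open MeasureTheory Set Function Filter Topology TopologicalSpace Metric
open scoped NNReal ENNReal

namespace Summit.NavierStokesRegularity.NavierStokesRegularity.Cruxes.SymmetricScarExists.RdssScrewSplit.GlueLanding

open Literature.Analysis.FluidPDE
open Summit.NavierStokesRegularity.NavierStokesRegularity.Theses.RellichScar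
open Summit.NavierStokesRegularity.NavierStokesRegularity.Theorems.SymmetricScarExists.Negative

set_option linter.dupNamespace false

/-- Local notation for physical space `ℝ³ = EuclideanSpace ℝ (Fin 3)`. -/
local notation "ℝ³" => EuclideanSpace ℝ (Fin 3)

/-- Local notation for the open backward slab `(-∞, 0) × ℝ³` (time first). -/
local notation "𝕊" => slab (EuclideanSpace ℝ (Fin 3)) (Iio (0 : ℝ)) isOpen_Iio

/-- **The glue of the screw split**: `RdssScarSelection → RdssScarRigidity → RdssApexFatal →
SymmetricScarExists`.  Given a singular apex profile, the selection yields one whose scar is fixed by a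
screw-dilation `(c, θ)` with `c > 1` or is axisymmetric; in the first case screw scar rigidity makes the
profile a.e. screw-invariant and the screw Fatal excludes it; in the second case the profile is itself a
witness of the crux's axisymmetric alternative. [folklore] -/
theorem symmetricScarExists_of_rdssSplit
    (hSel : ∀ C : ℝ, (∃ (u : ℝ → ℝ³ → ℝ³) (p : ℝ → ℝ³ → ℝ) (G : ℝ → ℝ³ → ℝ³ →L[ℝ] ℝ³),
        IsSuitableWeakSolutionOn 𝕊 1 0 u p ∧ HasWeakSpatialGradientOn 𝕊 u G ∧
        typeIBound (Iio (0 : ℝ) ×ˢ univ) u p G < ⊤ ∧ HasTypeIDecay C u ∧ IsBackwardSingularPoint u 0) →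
      ∃ (C' : ℝ) (u : ℝ → ℝ³ → ℝ³) (p : ℝ → ℝ³ → ℝ) (G : ℝ → ℝ³ → ℝ³ →L[ℝ] ℝ³),
        IsSuitableWeakSolutionOn 𝕊 1 0 u p ∧ HasWeakSpatialGradientOn 𝕊 u G ∧
        typeIBound (Iio (0 : ℝ) ×ˢ univ) u p G < ⊤ ∧ HasTypeIDecay C' u ∧ IsBackwardSingularPoint u 0 ∧
        ((∃ c θ : ℝ, 1 < c ∧ ∀ K : Set ℝ³, IsCompact K → (0 : ℝ³) ∉ K →
            Tendsto (fun δ : ℝ => eLpNorm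
              (uncurry (fun t x => rotZ θ (nsRescale c u t (rotZ (-θ) x))) - uncurry u) ⊤
              (volume.restrict (Ioo (-δ) 0 ×ˢ K))) (𝓝[>] 0) (𝓝 0)) ∨
         (∀ θ : ℝ, ∀ K : Set ℝ³, IsCompact K → (0 : ℝ³) ∉ K →
            Tendsto (fun δ : ℝ => eLpNorm
              (uncurry (fun t x => rotZ θ (u t (rotZ (-θ) x))) - uncurry u) ⊤
              (volume.restrict (Ioo (-δ) 0 ×ˢ K))) (𝓝[>] 0) (𝓝 0))))
    (hRig : ∀ (u : ℝ → ℝ³ → ℝ³) (p : ℝ → ℝ³ → ℝ) (G : ℝ → ℝ³ → ℝ³ →L[ℝ] ℝ³) (C c θ : ℝ),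
        IsSuitableWeakSolutionOn 𝕊 1 0 u p → HasWeakSpatialGradientOn 𝕊 u G →
        typeIBound (Iio (0 : ℝ) ×ˢ univ) u p G < ⊤ → HasTypeIDecay C u → IsBackwardSingularPoint u 0 →
        1 < c →
        (∀ K : Set ℝ³, IsCompact K → (0 : ℝ³) ∉ K →
            Tendsto (fun δ : ℝ => eLpNorm
              (uncurry (fun t x => rotZ θ (nsRescale c u t (rotZ (-θ) x))) - uncurry u) ⊤
              (volume.restrict (Ioo (-δ) 0 ×ˢ K))) (𝓝[>] 0) (𝓝 0)) →
        uncurry (fun t x => rotZ θ (nsRescale c u t (rotZ (-θ) x)))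
          =ᵐ[volume.restrict (Iio (0 : ℝ) ×ˢ (univ : Set ℝ³))] uncurry u)
    (hFatal : ∀ (u : ℝ → ℝ³ → ℝ³) (p : ℝ → ℝ³ → ℝ) (G : ℝ → ℝ³ → ℝ³ →L[ℝ] ℝ³) (C c θ : ℝ),
        IsSuitableWeakSolutionOn 𝕊 1 0 u p → HasWeakSpatialGradientOn 𝕊 u G →
        typeIBound (Iio (0 : ℝ) ×ˢ univ) u p G < ⊤ → HasTypeIDecay C u → IsBackwardSingularPoint u 0 →
        1 < c →
        uncurry (fun t x => rotZ θ (nsRescale c u t (rotZ (-θ) x)))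
          =ᵐ[volume.restrict (Iio (0 : ℝ) ×ˢ (univ : Set ℝ³))] uncurry u → False) :
    SymmetricScarExists := by
  intro C hex
  obtain ⟨C', u, p, G, hsw, hwg, hI, hdec, hsing, hsym⟩ := hSel C hex
  rcases hsym with ⟨c, θ, hc, hscar⟩ | hax
  · exact (hFatal u p G C' c θ hsw hwg hI hdec hsing hc
      (hRig u p G C' c θ hsw hwg hI hdec hsing hc hscar)).elim
  · exact ⟨C', u, p, G, hsw, hwg, hI, hdec, hsing, Or.inr hax⟩

/-- The untwisted screw-dilation is the plain rescaling: `R_0 ∘ D_c ∘ R_0⁻¹ = D_c`. [folklore] -/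
theorem rdss_zero_twist_eq (c : ℝ) (u : ℝ → ℝ³ → ℝ³) :
    (fun t x => rotZ 0 (nsRescale c u t (rotZ (-0) x))) = nsRescale c u := by
  funext t x
  simp only [neg_zero, rotZ_zero]

/-- **The selection child is weaker than the crux**: `SymmetricScarExists → RdssScarSelection`.  A
homogeneous scar is fixed by the untwisted screw-dilation `(c, θ) = (2, 0)`; an axisymmetric scar is the
second alternative verbatim. [folklore] -/
theorem rdssScarSelection_of_symmetricScarExists (hS : SymmetricScarExists) :
    ∀ C : ℝ, (∃ (u : ℝ → ℝ³ → ℝ³) (p : ℝ → ℝ³ → ℝ) (G : ℝ → ℝ³ → ℝ³ →L[ℝ] ℝ³),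
        IsSuitableWeakSolutionOn 𝕊 1 0 u p ∧ HasWeakSpatialGradientOn 𝕊 u G ∧
        typeIBound (Iio (0 : ℝ) ×ˢ univ) u p G < ⊤ ∧ HasTypeIDecay C u ∧ IsBackwardSingularPoint u 0) →
      ∃ (C' : ℝ) (u : ℝ → ℝ³ → ℝ³) (p : ℝ → ℝ³ → ℝ) (G : ℝ → ℝ³ → ℝ³ →L[ℝ] ℝ³),
        IsSuitableWeakSolutionOn 𝕊 1 0 u p ∧ HasWeakSpatialGradientOn 𝕊 u G ∧
        typeIBound (Iio (0 : ℝ) ×ˢ univ) u p G < ⊤ ∧ HasTypeIDecay C' u ∧ IsBackwardSingularPoint u 0 ∧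
        ((∃ c θ : ℝ, 1 < c ∧ ∀ K : Set ℝ³, IsCompact K → (0 : ℝ³) ∉ K →
            Tendsto (fun δ : ℝ => eLpNorm
              (uncurry (fun t x => rotZ θ (nsRescale c u t (rotZ (-θ) x))) - uncurry u) ⊤
              (volume.restrict (Ioo (-δ) 0 ×ˢ K))) (𝓝[>] 0) (𝓝 0)) ∨
         (∀ θ : ℝ, ∀ K : Set ℝ³, IsCompact K → (0 : ℝ³) ∉ K →
            Tendsto (fun δ : ℝ => eLpNorm
              (uncurry (fun t x => rotZ θ (u t (rotZ (-θ) x))) - uncurry u) ⊤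
              (volume.restrict (Ioo (-δ) 0 ×ˢ K))) (𝓝[>] 0) (𝓝 0))) := by
  intro C hex
  obtain ⟨C', u, p, G, hsw, hwg, hI, hdec, hsing, hsym⟩ := hS C hex
  refine ⟨C', u, p, G, hsw, hwg, hI, hdec, hsing, ?_⟩
  rcases hsym with hhom | hax
  · refine Or.inl ⟨2, 0, one_lt_two, ?_⟩
    rw [rdss_zero_twist_eq]
    exact hhom 2 two_pos
  · exact Or.inr hax

/-- **The rigidity child is weaker than `ScarRigidity`** (given the proved support
`SimilarityCovariance`): the screw-dilated profile `R_θ D_c u` lies in the apex class with the same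
constant and is singular at the origin (two uses of covariance), so `ScarRigidity` applied to the pair
`(R_θ D_c u, u)` is exactly screw scar rigidity. [folklore] -/
theorem rdssScarRigidity_of_scarRigidity_of_cov (hSR : ScarRigidity) (hCov : SimilarityCovariance) :
    ∀ (u : ℝ → ℝ³ → ℝ³) (p : ℝ → ℝ³ → ℝ) (G : ℝ → ℝ³ → ℝ³ →L[ℝ] ℝ³) (C c θ : ℝ),
        IsSuitableWeakSolutionOn 𝕊 1 0 u p → HasWeakSpatialGradientOn 𝕊 u G →
        typeIBound (Iio (0 : ℝ) ×ˢ univ) u p G < ⊤ → HasTypeIDecay C u → IsBackwardSingularPoint u 0 →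
        1 < c →
        (∀ K : Set ℝ³, IsCompact K → (0 : ℝ³) ∉ K →
            Tendsto (fun δ : ℝ => eLpNorm
              (uncurry (fun t x => rotZ θ (nsRescale c u t (rotZ (-θ) x))) - uncurry u) ⊤
              (volume.restrict (Ioo (-δ) 0 ×ˢ K))) (𝓝[>] 0) (𝓝 0)) →
        uncurry (fun t x => rotZ θ (nsRescale c u t (rotZ (-θ) x)))
          =ᵐ[volume.restrict (Iio (0 : ℝ) ×ˢ (univ : Set ℝ³))] uncurry u := by
  intro u p G C c θ hsw hwg hI hdec hsing hc hscar
  have hc0 : 0 < c := one_pos.trans hc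
  obtain ⟨q₁, H₁, hs₁, hg₁, hI₁, hd₁, hsing₁⟩ := (hCov u p G C hsw hwg hI hdec hsing).1 c hc0
  obtain ⟨q₂, H₂, hs₂, hg₂, hI₂, hd₂, hsing₂⟩ :=
    (hCov (nsRescale c u) q₁ H₁ C hs₁ hg₁ hI₁ hd₁ hsing₁).2 θ
  exact hSR _ q₂ H₂ u p G C hs₂ hg₂ hI₂ hd₂ hsw hwg hI hdec hsing₂ hsing hscar

/-- **`ScarRigidity → RdssScarRigidity`**, covariance discharged by the landed
`similarityCovariance_proof` (item stmt-NavierStokesRegularity-11720). [folklore] -/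
theorem rdssScarRigidity_of_scarRigidity (hSR : ScarRigidity) :
    ∀ (u : ℝ → ℝ³ → ℝ³) (p : ℝ → ℝ³ → ℝ) (G : ℝ → ℝ³ → ℝ³ →L[ℝ] ℝ³) (C c θ : ℝ),
        IsSuitableWeakSolutionOn 𝕊 1 0 u p → HasWeakSpatialGradientOn 𝕊 u G →
        typeIBound (Iio (0 : ℝ) ×ˢ univ) u p G < ⊤ → HasTypeIDecay C u → IsBackwardSingularPoint u 0 →
        1 < c →
        (∀ K : Set ℝ³, IsCompact K → (0 : ℝ³) ∉ K →
            Tendsto (fun δ : ℝ => eLpNorm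
              (uncurry (fun t x => rotZ θ (nsRescale c u t (rotZ (-θ) x))) - uncurry u) ⊤
              (volume.restrict (Ioo (-δ) 0 ×ˢ K))) (𝓝[>] 0) (𝓝 0)) →
        uncurry (fun t x => rotZ θ (nsRescale c u t (rotZ (-θ) x)))
          =ᵐ[volume.restrict (Iio (0 : ℝ) ×ˢ (univ : Set ℝ³))] uncurry u :=
  rdssScarRigidity_of_scarRigidity_of_cov hSR
    Summit.NavierStokesRegularity.NavierStokesRegularity.Theorems.RellichScarSimilarityCovariance.similarityCovariance_proof

/-- **The Fatal child is weaker than the target**: `NoApexTypeIProfile → RdssApexFatal` (there is no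
singular apex profile at all). [folklore] -/
theorem rdssApexFatal_of_noApexTypeIProfile (hX : NoApexTypeIProfile) :
    ∀ (u : ℝ → ℝ³ → ℝ³) (p : ℝ → ℝ³ → ℝ) (G : ℝ → ℝ³ → ℝ³ →L[ℝ] ℝ³) (C c θ : ℝ),
        IsSuitableWeakSolutionOn 𝕊 1 0 u p → HasWeakSpatialGradientOn 𝕊 u G →
        typeIBound (Iio (0 : ℝ) ×ˢ univ) u p G < ⊤ → HasTypeIDecay C u → IsBackwardSingularPoint u 0 →
        1 < c →
        uncurry (fun t x => rotZ θ (nsRescale c u t (rotZ (-θ) x)))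
          =ᵐ[volume.restrict (Iio (0 : ℝ) ×ˢ (univ : Set ℝ³))] uncurry u → False := by
  intro u p G C c θ hsw hwg hI hdec hsing _ _
  exact hX u p G C hsw hwg hI hdec hsing

/-- **The Fatal child contains Perelman's rotated-self-similar Liouville problem in apex form**:
`RdssApexFatal → ∀ α, RssApexFatal α` (an a.e. `α`-RSS profile is a.e. fixed by the screw-dilation
`(2, 2α log 2)`).  So the child is at least as strong as Pineau–Vicol 2026 Conj. 1.1 in the apex class,
of which `rssApexFatal_smallOrLargePitch` is the landed extreme-pitch corner. [cite: PineauVicol2026, Conjecture 1.1 and Remark 1.5 (arXiv:2607.09619 pp. 3, 5)] -/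
theorem rssApexFatal_of_rdssApexFatal
    (hFatal : ∀ (u : ℝ → ℝ³ → ℝ³) (p : ℝ → ℝ³ → ℝ) (G : ℝ → ℝ³ → ℝ³ →L[ℝ] ℝ³) (C c θ : ℝ),
        IsSuitableWeakSolutionOn 𝕊 1 0 u p → HasWeakSpatialGradientOn 𝕊 u G →
        typeIBound (Iio (0 : ℝ) ×ˢ univ) u p G < ⊤ → HasTypeIDecay C u → IsBackwardSingularPoint u 0 →
        1 < c →
        uncurry (fun t x => rotZ θ (nsRescale c u t (rotZ (-θ) x)))
          =ᵐ[volume.restrict (Iio (0 : ℝ) ×ˢ (univ : Set ℝ³))] uncurry u → False) (α : ℝ) :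
    RssApexFatal α := by
  intro u p G C hsw hwg hI hdec hsing hrss
  exact hFatal u p G C 2 (2 * α * Real.log 2) hsw hwg hI hdec hsing one_lt_two (hrss 2 two_pos)

/-- **The Fatal child kills a.e. self-similar singular apex profiles** (the hypothesis of the proved
support `SelfSimilarApexFatal`, case `(c, θ) = (2, 0)`): calibration that the untwisted end of the
child is Leray's self-similar exclusion (Tsai 1998). [cite: Tsai1998, Thm 2] -/
theorem selfSimilar_hypothesis_of_rdssApexFatal
    (hFatal : ∀ (u : ℝ → ℝ³ → ℝ³) (p : ℝ → ℝ³ → ℝ) (G : ℝ → ℝ³ → ℝ³ →L[ℝ] ℝ³) (C c θ : ℝ),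
        IsSuitableWeakSolutionOn 𝕊 1 0 u p → HasWeakSpatialGradientOn 𝕊 u G →
        typeIBound (Iio (0 : ℝ) ×ˢ univ) u p G < ⊤ → HasTypeIDecay C u → IsBackwardSingularPoint u 0 →
        1 < c →
        uncurry (fun t x => rotZ θ (nsRescale c u t (rotZ (-θ) x)))
          =ᵐ[volume.restrict (Iio (0 : ℝ) ×ˢ (univ : Set ℝ³))] uncurry u → False)
    (u : ℝ → ℝ³ → ℝ³) (p : ℝ → ℝ³ → ℝ) (G : ℝ → ℝ³ → ℝ³ →L[ℝ] ℝ³) (C : ℝ)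
    (hsw : IsSuitableWeakSolutionOn 𝕊 1 0 u p) (hwg : HasWeakSpatialGradientOn 𝕊 u G)
    (hI : typeIBound (Iio (0 : ℝ) ×ˢ univ) u p G < ⊤) (hdec : HasTypeIDecay C u)
    (hsing : IsBackwardSingularPoint u 0)
    (hss : ∀ lam : ℝ, 0 < lam →
      uncurry (nsRescale lam u) =ᵐ[volume.restrict (Iio (0 : ℝ) ×ˢ (univ : Set ℝ³))] uncurry u) :
    False := by
  refine hFatal u p G C 2 0 hsw hwg hI hdec hsing one_lt_two ?_
  rw [rdss_zero_twist_eq]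
  exact hss 2 two_pos

/-- **Readback of the split against the target** (the costume made explicit, one level down): granting
`ScarRigidity` and the screw Fatal, the selection child is equivalent to the target `NoApexTypeIProfile`
— exactly as `S ↔ X` under `ScarRigidity` (`Negative.symmetricScarExists_iff_noApexTypeIProfile`).  The
content of the split is therefore the SEPARATION of the three technique classes (selection by dynamics /
backward uniqueness within a symmetry orbit / (R)DSS Liouville), not a weakening of their conjunction.
[folklore] -/
theorem rdssScarSelection_iff_noApexTypeIProfile (hSR : ScarRigidity)
    (hFatal : ∀ (u : ℝ → ℝ³ → ℝ³) (p : ℝ → ℝ³ → ℝ) (G : ℝ → ℝ³ → ℝ³ →L[ℝ] ℝ³) (C c θ : ℝ),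
        IsSuitableWeakSolutionOn 𝕊 1 0 u p → HasWeakSpatialGradientOn 𝕊 u G →
        typeIBound (Iio (0 : ℝ) ×ˢ univ) u p G < ⊤ → HasTypeIDecay C u → IsBackwardSingularPoint u 0 →
        1 < c →
        uncurry (fun t x => rotZ θ (nsRescale c u t (rotZ (-θ) x)))
          =ᵐ[volume.restrict (Iio (0 : ℝ) ×ˢ (univ : Set ℝ³))] uncurry u → False) :
    (∀ C : ℝ, (∃ (u : ℝ → ℝ³ → ℝ³) (p : ℝ → ℝ³ → ℝ) (G : ℝ → ℝ³ → ℝ³ →L[ℝ] ℝ³),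
        IsSuitableWeakSolutionOn 𝕊 1 0 u p ∧ HasWeakSpatialGradientOn 𝕊 u G ∧
        typeIBound (Iio (0 : ℝ) ×ˢ univ) u p G < ⊤ ∧ HasTypeIDecay C u ∧ IsBackwardSingularPoint u 0) →
      ∃ (C' : ℝ) (u : ℝ → ℝ³ → ℝ³) (p : ℝ → ℝ³ → ℝ) (G : ℝ → ℝ³ → ℝ³ →L[ℝ] ℝ³),
        IsSuitableWeakSolutionOn 𝕊 1 0 u p ∧ HasWeakSpatialGradientOn 𝕊 u G ∧
        typeIBound (Iio (0 : ℝ) ×ˢ univ) u p G < ⊤ ∧ HasTypeIDecay C' u ∧ IsBackwardSingularPoint u 0 ∧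
        ((∃ c θ : ℝ, 1 < c ∧ ∀ K : Set ℝ³, IsCompact K → (0 : ℝ³) ∉ K →
            Tendsto (fun δ : ℝ => eLpNorm
              (uncurry (fun t x => rotZ θ (nsRescale c u t (rotZ (-θ) x))) - uncurry u) ⊤
              (volume.restrict (Ioo (-δ) 0 ×ˢ K))) (𝓝[>] 0) (𝓝 0)) ∨
         (∀ θ : ℝ, ∀ K : Set ℝ³, IsCompact K → (0 : ℝ³) ∉ K →
            Tendsto (fun δ : ℝ => eLpNorm
              (uncurry (fun t x => rotZ θ (u t (rotZ (-θ) x))) - uncurry u) ⊤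
              (volume.restrict (Ioo (-δ) 0 ×ˢ K))) (𝓝[>] 0) (𝓝 0)))) ↔
    NoApexTypeIProfile := by
  constructor
  · intro hSel
    have hS : SymmetricScarExists :=
      symmetricScarExists_of_rdssSplit hSel (rdssScarRigidity_of_scarRigidity hSR) hFatal
    exact (symmetricScarExists_iff_noApexTypeIProfile hSR
      Summit.NavierStokesRegularity.NavierStokesRegularity.Theorems.RellichScarSimilarityCovariance.similarityCovariance_proof
      Summit.NavierStokesRegularity.NavierStokesRegularity.Theorems.rellichScar_selfSimilarApexFatal_proof
      Summit.NavierStokesRegularity.NavierStokesRegularity.Theorems.rellichScar_axisymmetricApexFatal_proof).1 hS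
  · intro hX
    exact rdssScarSelection_of_symmetricScarExists (symmetricScarExists_of_noApexTypeIProfile hX)

end Summit.NavierStokesRegularity.NavierStokesRegularity.Cruxes.SymmetricScarExists.RdssScrewSplit.GlueLanding

end
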